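import Summits.BirchSwinnertonDyer.Rank1Residual.Additive.X3BranchDegenerateEndStateClasses
import Summits.BirchSwinnertonDyer.Rank1Residual.Additive.X3BranchResidualQuotSelmerLayerLowerBound
import HarnessLib

/-!
# X3, the DEGENERATE rows at `p = 3`, rank `0`, OFF the sub-locus: `BSD₃` from EXHIBITED classes with the
# U-side classes taken over the FIRST LAYER `ℚ_1 = ℚ(ζ₉)⁺` (cell `bsd-eis`, seat `bsd-eis-x3` gen 7;
# sequel of gen 6's `X3BranchDegenerateEndStateClasses.lean`, with
# `X3Branch.pow_card_le_natCard_residualQuotSelmer_of_trivialLine_layerOne` in place of the rational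
# U-side bound; route K1 `AdditiveBranchIMC`, crux `GordTwoRankZeroOffCaseOne` — supports only)

HONEST FRAMING (FULL-BSD rank-`≤ 1` programme D-0033, cell `bsd-eis`): nothing is booked and no label
moves here; THEOREMS ONLY. The end state
`ClassX3Gord.bsdp_three_rankZero_degenerate_of_facts_of_torsionFact_of_cardGe` (gen 6) with its
finiteness-conditional lower bound `hnge : 3^{n+Σδ+1} ≤ #H¹(ℚ_Σ/ℚ_∞, Φ₀)·#U(W[3]/Φ₀)` DISCHARGED by
* gen 6's T-side classes (order-`3` sub-characters of `χ_ℓ`, `ℓ ∈ T`, `ℓ ≡ 1 (3)`: `3^{#T} ≤ #H¹`), and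
* the LAYER-ONE U-side classes of this seat: `ι` units `a_i = P_i(θ)` of `ℚ_1` (`θ = ζ + ζ⁸`) with
  conjugate / cube / norm data and a cubic-residue independence certificate (`3^{#ι} ≤ #U`),
under the arithmetic `n + Σδ + 1 ≤ #T + #ι`. On a row whose primes `ℓ ∈ Σ₀` with `s_ℓ > 1` are all
`≡ 8 (mod 9)` (so the T-side count `Σ_{ℓ≡1(3)} s_ℓ` is still `#T`) this exhausts Greenberg–Vatsal's
count with `#ι = Σ_ℓ s_ℓ − 1` (233 of the 596 off-locus rank-`0` classes: 103 unit rows, 130 with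
`n ≥ 2`). The per-pair inputs that stay displayed: the 11 PUBLISHED records, the class / `Σ₀` / line data,
and `hcert` at index `n`. [cite: GreenbergVatsal2000, §2 pp. 26–30] [cite: GreenbergLNM1716, §3 p. 86]
[cite: Delbourgo1998, Prop. 4] [cite: Wuthrich2014, Thm. 16]
-/

set_option autoImplicit false

noncomputable section

open scoped Classical

namespace Summit.BirchSwinnertonDyer.Rank1Residual.Additive

open WeierstrassCurve NumberField IsDedekindDomain Field
  Literature.NumberTheory.EllipticCurves
  Literature.NumberTheory.EllipticCurves.ModularForms
  Literature.NumberTheory.EllipticCurves.GreenbergSelmer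
  Literature.NumberTheory.EllipticCurves.GreenbergVatsal2000
  Literature.NumberTheory.EllipticCurves.Rank1Residual
  Literature.NumberTheory.EllipticCurves.Rank1Residual.Typed
  Literature.NumberTheory.GaloisRepresentations
  Summit.BirchSwinnertonDyer.Rank1Residual.X1.MuLambda
  Summit.BirchSwinnertonDyer.Rank1Residual.AdditivePotMult
  Summit.BirchSwinnertonDyer.Rank1Residual.Additive.X3Branch

/-- **`BSD₃(W)` on the DEGENERATE X3♯(G-ord, `e = 2`) rows of rank `0` from EXHIBITED classes, the
U-side classes over the first layer `ℚ_1`.** As gen 6's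
`ClassX3Gord.bsdp_three_rankZero_degenerate_of_facts_of_torsionFact_of_classes`, with the family of
rational `Σ₀`-units replaced by the layer-one data of
`X3Branch.pow_card_le_natCard_residualQuotSelmer_of_trivialLine_layerOne` (units `P_i(θ)`, conjugates,
cube certificates `P·D³ = 1 + 9T`, norms supported on `Σ₀`, cubic-residue independence certificate),
under `n + Σ_{v∈Σ₀} δ_v + 1 ≤ #T + #ι`. [cite: GreenbergVatsal2000, §2 pp. 26–30]
[cite: GreenbergLNM1716, §3 p. 86] [cite: Delbourgo1998, Prop. 4] [cite: Wuthrich2014, Thm. 16] -/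
theorem ClassX3Gord.bsdp_three_rankZero_degenerate_of_facts_of_torsionFact_of_layerClasses
    [Fact (Nat.Prime 3)] {W : WeierstrassCurve ℚ} [W.IsElliptic] [W.IsGloballyMinimal]
    (hTors : Greenberg1999.finite_torsion_cyclotomicZpExtension)
    (hDelG : Delbourgo1998.prop4_rankZero_constantCoeff_eq_unit_mul_of_potGoodOrd)
    (hDel98 : Delbourgo1998.prop4_rankZero_pow_dvd_constantCoeff)
    (hGZK : rank_eq_analyticRank_of_analyticRank_le_one) (hmod : hasEntireLFunction_rat)
    (hmodD : nonempty_modularParametrizationData)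
    (hW16 : Wuthrich2014.thm16_halfEigenCharIdeal_dvd_cyclotomicPrime)
    (h23 : datumSelmer_nonPrimitive_invariants)
    (hRQ : datumSelmer_divisible_of_finite_torsionBy_of_gr_inertiaInvariants_eq_zero)
    (hGrK : Greenberg1999.imKummer_ge_strictCondition_goodOrdinary)
    (hLiftE : residualEpsilon_surjOn_of_lineEven)
    (hX : ClassX3Gord W 3) (hr : W.analyticRank = 0)
    (S₀ : Finset (HeightOneSpectrum (𝓞 ℚ))) (hne : S₀.Nonempty)
    (hS₀ : ∀ v ∈ S₀, (((3 : ℕ) : ℕ) : 𝓞 ℚ) ∉ v.asIdeal)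
    (hS : ∀ v : HeightOneSpectrum (𝓞 ℚ), v ∉ S₀ → (((3 : ℕ) : ℕ) : 𝓞 ℚ) ∉ v.asIdeal →
      W.HasGoodReductionAt v)
    (Φ₀ : AddSubgroup (W.geomTorsion ((3 : ℕ) : ℤ))) (hΦ : IsRationalLine W 3 Φ₀)
    (htriv : ∀ (σ : absoluteGaloisGroup ℚ) (Pt : geomTorsion W ((3 : ℕ) : ℤ)), Pt ∈ Φ₀ → σ • Pt = Pt)
    {n : ℕ}
    (hcert : ∀ (V : WeierstrassCurve ℚ) [V.IsElliptic] [V.IsGloballyMinimal] (C : VariableChange ℚ),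
      C • V.quadraticTwist ((-1) ^ ((3 : ℕ) / 2) * (3 : ℕ) : ℚ) = W → X3BranchUnitCoeffCertAt V 3 n)
    -- T-side (gen 6)
    (T : Finset ℕ) (hT : ∀ ℓ ∈ T, ℓ.Prime ∧ 3 ∣ ℓ - 1 ∧ ∃ v ∈ S₀, ((ℓ : ℕ) : 𝓞 ℚ) ∈ v.asIdeal)
    -- U-side over `ℚ_1`
    {ζ : AlgebraicClosure ℚ} (hζ : IsPrimitiveRoot ζ 9)
    {ι : Type} [Fintype ι] [DecidableEq ι] (P : ι → Fin 3 → Fin 3 → ℤ)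
    (hconj1 : ∀ i, (P i 0 0 : AlgebraicClosure ℚ) + P i 0 1 * ((ζ + ζ ^ 8) ^ 2 - 2) +
      P i 0 2 * ((ζ + ζ ^ 8) ^ 2 - 2) ^ 2 =
      (P i 1 0 : AlgebraicClosure ℚ) + P i 1 1 * (ζ + ζ ^ 8) + P i 1 2 * (ζ + ζ ^ 8) ^ 2)
    (hconj2 : ∀ i, (P i 0 0 : AlgebraicClosure ℚ) + P i 0 1 * (-(ζ + ζ ^ 8) ^ 2 - (ζ + ζ ^ 8) + 2) +
      P i 0 2 * (-(ζ + ζ ^ 8) ^ 2 - (ζ + ζ ^ 8) + 2) ^ 2 =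
      (P i 2 0 : AlgebraicClosure ℚ) + P i 2 1 * (ζ + ζ ^ 8) + P i 2 2 * (ζ + ζ ^ 8) ^ 2)
    (D Tc : ι → Fin 3 → Fin 3 → ℤ)
    (hcube : ∀ i j, ((P i j 0 : AlgebraicClosure ℚ) + P i j 1 * (ζ + ζ ^ 8) + P i j 2 * (ζ + ζ ^ 8) ^ 2) *
      ((D i j 0 : AlgebraicClosure ℚ) + D i j 1 * (ζ + ζ ^ 8) + D i j 2 * (ζ + ζ ^ 8) ^ 2) ^ 3 =
      1 + 9 * ((Tc i j 0 : AlgebraicClosure ℚ) + Tc i j 1 * (ζ + ζ ^ 8) + Tc i j 2 * (ζ + ζ ^ 8) ^ 2))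
    (nm : ι → ℕ) (hn0 : ∀ i, nm i ≠ 0)
    (hnorm : ∀ i, ((P i 0 0 : AlgebraicClosure ℚ) + P i 0 1 * (ζ + ζ ^ 8) + P i 0 2 * (ζ + ζ ^ 8) ^ 2) *
      (((P i 1 0 : AlgebraicClosure ℚ) + P i 1 1 * (ζ + ζ ^ 8) + P i 1 2 * (ζ + ζ ^ 8) ^ 2) *
        ((P i 2 0 : AlgebraicClosure ℚ) + P i 2 1 * (ζ + ζ ^ 8) + P i 2 2 * (ζ + ζ ^ 8) ^ 2)) = nm i)
    (hnS : ∀ i (v : HeightOneSpectrum (𝓞 ℚ)), ((nm i : ℕ) : 𝓞 ℚ) ∈ v.asIdeal → v ∈ S₀)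
    {R : ℕ} (q : Fin R → ℕ) (hq : ∀ ρ, (q ρ).Prime) (hq1 : ∀ ρ, 3 ∣ q ρ - 1)
    (r : (ρ : Fin R) → Fin 3 → ZMod (q ρ)) (hrr : ∀ ρ kk, r ρ kk ^ 3 - 3 * r ρ kk + 1 = 0)
    (w : (ρ : Fin R) → Fin 3 → Fin 3 → ZMod (q ρ))
    (hw : ∀ ρ (c c' : Fin 3), ∑ kk, w ρ c kk * r ρ kk ^ c'.val = if c = c' then 1 else 0)
    (ω : (ρ : Fin R) → ZMod (q ρ)) (hω : ∀ ρ, ω ρ ^ 3 = 1 ∧ ω ρ ≠ 1)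
    (e : Fin R → ι → ℕ)
    (he : ∀ ρ i, ((P i 0 0 : ZMod (q ρ)) + (P i 0 1 : ZMod (q ρ)) * r ρ 0 +
      (P i 0 2 : ZMod (q ρ)) * r ρ 0 ^ 2) ^ ((q ρ - 1) / 3) = ω ρ ^ e ρ i)
    (hnz : ∀ ρ i, (P i 0 0 : ZMod (q ρ)) + (P i 0 1 : ZMod (q ρ)) * r ρ 0 +
      (P i 0 2 : ZMod (q ρ)) * r ρ 0 ^ 2 ≠ 0)
    (L : ι → Fin R → ℤ)
    (hL : ∀ i i', (∑ ρ, (L i ρ : ZMod 3) * (e ρ i' : ZMod 3)) = if i = i' then 1 else 0)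
    (hcount : n + ∑ v ∈ S₀, delta W 3 v + 1 ≤ T.card + Fintype.card ι) :
    BSDp W 3 := by
  refine ClassX3Gord.bsdp_three_rankZero_degenerate_of_facts_of_torsionFact_of_cardGe hTors hDelG
    hDel98 hGZK hmod hmodD hW16 h23 hRQ hGrK hLiftE hX hr S₀ hne hS₀ hS Φ₀ hΦ htriv hcert
    fun κ hκ hH hU ↦ ?_
  haveI := hH
  haveI := hU
  calc 3 ^ (n + ∑ v ∈ S₀, delta W 3 v + 1) ≤ 3 ^ (T.card + Fintype.card ι) :=
        Nat.pow_le_pow_right (by norm_num) hcount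
    _ = 3 ^ T.card * 3 ^ Fintype.card ι := pow_add _ _ _
    _ ≤ Nat.card (residualLineH1 W 3 κ S₀ Φ₀ hΦ) * Nat.card (residualQuotSelmer W 3 κ S₀ Φ₀ hΦ) :=
        Nat.mul_le_mul
          (X3Branch.pow_card_le_natCard_residualLineH1_of_trivialLine κ hκ S₀ hS₀ hΦ htriv T hT)
          (X3Branch.pow_card_le_natCard_residualQuotSelmer_of_trivialLine_layerOne κ hκ S₀ hΦ htriv hζ
            P hconj1 hconj2 D Tc hcube nm hn0 hnorm hnS q hq hq1 r hrr w hw ω hω e he hnz L hL)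

end Summit.BirchSwinnertonDyer.Rank1Residual.Additive

end
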